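import Mathlib.Data.ZMod.Basic
import Mathlib.Algebra.Squarefree.Basic
import Mathlib.Tactic.Ring
import Mathlib.Tactic.Linarith
import Mathlib.Tactic.NormNum
import Mathlib.Tactic.LinearCombination
import Mathlib.Tactic.IntervalCases
import Literature.NumberTheory.NumberFields.EisensteinFieldIntegers
import HarnessLib

/-!
# Venture HSemireg — THEOREM R1-DIOPHANTINE's arithmetic (ENGINE-W PROBE5 §13): the gcd step of LEMMA 𝔭, the `α₀·τ(α₀)` identity and
# the Eisenstein last step of LEMMA ∥, and the table «`x² − m·y² = 2` is solvable» for squarefree `m ≤ 200` (reached list by witnesses,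
# never list `m ≤ 43` by a one-prime residue obstruction, parities of the solutions) — kernel number theory

HONEST FRAMING. Lean index of the computation cell `pub-hsemireg`, widening group ENGINE-W (code A, seat `engine-w-1`, gen 18).
ELEMENTARY NUMBER THEORY AND RING IDENTITIES ONLY; no abelian variety, sheaf, `Ext` group, secant structure, autoequivalence or
semiregularity map is constructed; nothing here says that HC, HC_CM or HC_AV holds. Theorems only (0 `def`, 0 named fact, 0 `sorry`).
New namespace `R1Diophantine`. Companion of `LineDiophantineArithmetic.lean` (which holds the `m ≡ 1 (mod 4)` exclusion
`norm_ne_two_of_one_mod_four` and the imaginary line tables) and of `NonNormObstructions.lean` (homogeneous ternary non-norm descents).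

SOURCE (the cell's own result, by value): `widen/ENGINE-W/out/probe5/PROBE5-STIZ-A.md` §13 «THE PRIME OVER 2: I₂ = ½𝔭·I₁ FOR EVERY
TARGET ⇒ THEOREM R1-DIOPHANTINE: the ±√m seed reaches R1 PROPER ⟺ x² − m·y² = 2 is solvable in ℤ ⟺ a FACTORWISE word does it». What the
kernel holds:

* §1 **the gcd step of LEMMA 𝔭** («an odd prime p dividing N, t and A would give p² ∣ Nt = A² − m and p ∣ A, hence p² ∣ m»):
  `sq_dvd_of_common_divisor` (any common divisor `p` of `N, t, A` with `N·t = A² − m` has `p² ∣ m`) and `common_divisor_isUnit`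
  (so for squarefree `m` every common divisor is a unit: `gcd(N, t, A) = 1`).
* §2 **LEMMA ∥'s two computations**: `alpha_tau_alpha` (in any commutative ring with `l² = m`:
  `(p + q·l)(P − Q·l) = (pP − qQ·m) + (qP − pQ)·l` — the printed `α₀τ(α₀) = (N(p) − m·N(q)) + (q·p̄ − p·q̄)·l` with the conjugates as
  independent variables) and the Eisenstein last step
  `last_step` (using the tree's `Literature…K3.norm_int_ne_two`: `a² − ab + b² ≠ 2`, `2` inert in `ℤ[ω]`) (`(a² − ab + b²)·n = 2 ⟹ a² − ab + b² = 1 ∧ n = 2` — the printed «N(w)·(r² − m·s²) = 2 with N(w) ∈ {1} ⟹ r² − m·s² = 2»).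
* §3 **the residue obstruction** `ne_two_of_dvd_of_two_nonsquare` (`q ∣ m` and `2` not a square mod `q` ⟹ `x² − m·y² ≠ 2`; no primality
  needed) and COROLLARY (c)'s NEVER list up to `43`: `never_list` (`m = 3, 6, 10, 11, 15, 19, 22, 26, 30, 35, 38, 39, 42, 43` via
  `q = 3, 3, 5, 11, 3, 19, 11, 13, 3, 5, 19, 3, 3, 43`, each `q ≡ ±3 (mod 8)`).
* §4 **COROLLARY (c)'s REACHED list** (`m ≤ 200` squarefree): `reached_list` — explicit `(x, y)` with `x² − m·y² = 2` for
  `m = 2, 7, 14, 23, 31, 34, 46, 47, 62, 71, 79, 94, 103, 119, 127, 142, 151, 158, 167, 191, 194, 199` (smallest witnesses; the printed ones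
  `31 ↦ (39,7)`, `46 ↦ (156,23)`, `71 ↦ (59,7)`, `94 ↦ (1464,151)`, `151 ↦ (41571,3383)`, `199 ↦ (127539,9041)` included), and the
  `y = 1` family `family_y_one` (`m = b² − 2`).
* §5 **parities of a solution** (the CF⁶ step «z ∣ A − l ⟺ A ≡ 1 (mod 2) for m odd (x, y odd) resp. A ≡ 0 (mod 2) for m even (x even,
  y odd)»): `parity_of_three_mod_four` (`m ≡ 3 (4)`: `x, y` odd) and `parity_of_two_mod_four` (`m ≡ 2 (4)`: `x` even, `y` odd).
-/

namespace Summit.Ventures.HSemireg.R1Diophantine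

/-! ## §1 The gcd step of LEMMA 𝔭 -/

/-- **gcd step**: if `p` divides `N`, `t` and `A` and `N·t = A² − m`, then `p² ∣ m`. [kernel] -/
theorem sq_dvd_of_common_divisor {p N t A m : ℤ} (hN : p ∣ N) (ht : p ∣ t) (hA : p ∣ A) (h : N * t = A ^ 2 - m) :
    p ^ 2 ∣ m := by
  have hm : m = A ^ 2 - N * t := by linarith
  rw [hm]
  exact dvd_sub (pow_dvd_pow_of_dvd hA 2) (by rw [pow_two]; exact mul_dvd_mul hN ht)

/-- Hence for **squarefree `m`** every common divisor of `N, t, A` is a unit (`±1`): `gcd(N, t, A) = 1`, the printed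
«gcd(N∕2, t, A) = 1». [kernel] -/
theorem common_divisor_isUnit {p N t A m : ℤ} (hm : Squarefree m) (hN : p ∣ N) (ht : p ∣ t) (hA : p ∣ A)
    (h : N * t = A ^ 2 - m) : IsUnit p := by
  have h2 := sq_dvd_of_common_divisor hN ht hA h
  rw [pow_two] at h2
  exact hm p h2

/-- In particular no prime (indeed no non-unit) divides `N`, `t` and `A` simultaneously. [kernel] -/
theorem no_common_nonunit {p N t A m : ℤ} (hm : Squarefree m) (hp : ¬ IsUnit p) (hN : p ∣ N) (ht : p ∣ t) (hA : p ∣ A)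
    (h : N * t = A ^ 2 - m) : False :=
  hp (common_divisor_isUnit hm hN ht hA h)

/-! ## §2 LEMMA ∥: the `α₀·τ(α₀)` identity and the Eisenstein last step -/

/-- **`α₀·τ(α₀)`** with the conjugates as independent variables: in any commutative ring with `l² = m`,
`(p + q·l)·(P − Q·l) = (p·P − q·Q·m) + (q·P − p·Q)·l` (read `P = p̄`, `Q = q̄`: `α₀τ(α₀) = (N(p) − m·N(q)) + (q·p̄ − p·q̄)·l`). [kernel, `ring`] -/
theorem alpha_tau_alpha {R : Type*} [CommRing R] (p q P Q l m : R) (hl : l * l = m) :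
    (p + q * l) * (P - Q * l) = (p * P - q * Q * m) + (q * P - p * Q) * l := by
  linear_combination (-(q * Q)) * hl

/-- So `α₀·τ(α₀)` lies in the base ring (has no `l`-part) iff `q·P = p·Q`, i.e. `p·q̄ = q·p̄` («`p·q̄ ∈ ℚ`»); with that relation the
product is `p·P − q·Q·m`. [kernel] -/
theorem alpha_tau_alpha_rational {R : Type*} [CommRing R] (p q P Q l m : R) (hl : l * l = m) (hpar : q * P = p * Q) :
    (p + q * l) * (P - Q * l) = p * P - q * Q * m := by
  rw [alpha_tau_alpha p q P Q l m hl, hpar, sub_self, zero_mul, add_zero]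

/-- **LEMMA ∥, last step**: `N(w)·(r² − m·s²) = 2` with `N(w) = a² − ab + b²` forces `N(w) = 1` and `r² − m·s² = 2`
(a nonnegative divisor of `2` other than `2` is `1`). [kernel] -/
theorem last_step (a b n : ℤ) (h : (a ^ 2 - a * b + b ^ 2) * n = 2) : a ^ 2 - a * b + b ^ 2 = 1 ∧ n = 2 := by
  -- `2` is inert in `ℤ[ω]` (the tree's `K3.norm_int_ne_two`, Ireland–Rosen 9.1.4) and the form is nonnegative
  have h2 := Literature.NumberTheory.NumberFields.K3.norm_int_ne_two a b
  have h0 : 0 ≤ a ^ 2 - a * b + b ^ 2 := by nlinarith [sq_nonneg (2 * a - b), sq_nonneg b]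
  set N := a ^ 2 - a * b + b ^ 2 with hN
  have hd : N ∣ 2 := ⟨n, h.symm⟩
  have hle : N ≤ 2 := Int.le_of_dvd (by norm_num) hd
  have hne0 : N ≠ 0 := by rintro hz; rw [hz, zero_mul] at h; norm_num at h
  have hN1 : N = 1 := by interval_cases N <;> first | exact absurd rfl hne0 | rfl | exact absurd rfl h2
  refine ⟨hN1, ?_⟩
  rw [hN1, one_mul] at h
  exact h

/-! ## §3 The residue obstruction and COROLLARY (c)'s NEVER list -/

/-- **Residue obstruction**: if `q ∣ m` and `2` is not a square modulo `q`, then `x² − m·y² ≠ 2` for all integers `x, y`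
(reduce mod `q`: `x² = 2`; hypothesis as `∀ r, r² ≠ 2` in `ZMod q`). No primality of `q` is needed. [kernel] -/
theorem ne_two_of_dvd_of_two_nonsquare {q : ℕ} {m : ℤ} (hqm : (q : ℤ) ∣ m) (h2 : ∀ r : ZMod q, r ^ 2 ≠ 2) (x y : ℤ) :
    x ^ 2 - m * y ^ 2 ≠ 2 := by
  intro h
  have hm0 : (m : ZMod q) = 0 := (ZMod.intCast_zmod_eq_zero_iff_dvd m q).2 hqm
  have hc := congrArg (fun t : ℤ => (t : ZMod q)) h
  push_cast at hc
  rw [hm0, zero_mul, sub_zero] at hc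
  exact h2 (x : ZMod q) hc

/-- **COROLLARY (c), NEVER list up to `43`** (squarefree `m ≢ 1 (mod 4)` not in the reached list): `x² − m·y² = 2` has no solution for
`m = 3, 6, 10, 11, 15, 19, 22, 26, 30, 35, 38, 39, 42, 43` — witness divisors `q = 3, 3, 5, 11, 3, 19, 11, 13, 3, 5, 19, 3, 3, 43`
(`2` is a non-residue mod each, `q ≡ ±3 (mod 8)`). [kernel, `decide` for the fourteen residue facts] -/
theorem never_list (x y : ℤ) :
    x ^ 2 - 3 * y ^ 2 ≠ 2 ∧ x ^ 2 - 6 * y ^ 2 ≠ 2 ∧ x ^ 2 - 10 * y ^ 2 ≠ 2 ∧ x ^ 2 - 11 * y ^ 2 ≠ 2 ∧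
    x ^ 2 - 15 * y ^ 2 ≠ 2 ∧ x ^ 2 - 19 * y ^ 2 ≠ 2 ∧ x ^ 2 - 22 * y ^ 2 ≠ 2 ∧ x ^ 2 - 26 * y ^ 2 ≠ 2 ∧
    x ^ 2 - 30 * y ^ 2 ≠ 2 ∧ x ^ 2 - 35 * y ^ 2 ≠ 2 ∧ x ^ 2 - 38 * y ^ 2 ≠ 2 ∧ x ^ 2 - 39 * y ^ 2 ≠ 2 ∧
    x ^ 2 - 42 * y ^ 2 ≠ 2 ∧ x ^ 2 - 43 * y ^ 2 ≠ 2 := by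
  have n3 : ∀ r : ZMod 3, r ^ 2 ≠ 2 := by decide
  have n5 : ∀ r : ZMod 5, r ^ 2 ≠ 2 := by decide
  have n11 : ∀ r : ZMod 11, r ^ 2 ≠ 2 := by decide
  have n13 : ∀ r : ZMod 13, r ^ 2 ≠ 2 := by decide
  have n19 : ∀ r : ZMod 19, r ^ 2 ≠ 2 := by decide
  have n43 : ∀ r : ZMod 43, r ^ 2 ≠ 2 := by decide
  refine ⟨?_, ?_, ?_, ?_, ?_, ?_, ?_, ?_, ?_, ?_, ?_, ?_, ?_, ?_⟩
  · exact ne_two_of_dvd_of_two_nonsquare (q := 3) (m := 3) (by norm_num) n3 x y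
  · exact ne_two_of_dvd_of_two_nonsquare (q := 3) (m := 6) (by norm_num) n3 x y
  · exact ne_two_of_dvd_of_two_nonsquare (q := 5) (m := 10) (by norm_num) n5 x y
  · exact ne_two_of_dvd_of_two_nonsquare (q := 11) (m := 11) (by norm_num) n11 x y
  · exact ne_two_of_dvd_of_two_nonsquare (q := 3) (m := 15) (by norm_num) n3 x y
  · exact ne_two_of_dvd_of_two_nonsquare (q := 19) (m := 19) (by norm_num) n19 x y
  · exact ne_two_of_dvd_of_two_nonsquare (q := 11) (m := 22) (by norm_num) n11 x y
  · exact ne_two_of_dvd_of_two_nonsquare (q := 13) (m := 26) (by norm_num) n13 x y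
  · exact ne_two_of_dvd_of_two_nonsquare (q := 3) (m := 30) (by norm_num) n3 x y
  · exact ne_two_of_dvd_of_two_nonsquare (q := 5) (m := 35) (by norm_num) n5 x y
  · exact ne_two_of_dvd_of_two_nonsquare (q := 19) (m := 38) (by norm_num) n19 x y
  · exact ne_two_of_dvd_of_two_nonsquare (q := 3) (m := 39) (by norm_num) n3 x y
  · exact ne_two_of_dvd_of_two_nonsquare (q := 3) (m := 42) (by norm_num) n3 x y
  · exact ne_two_of_dvd_of_two_nonsquare (q := 43) (m := 43) (by norm_num) n43 x y

/-! ## §4 COROLLARY (c)'s REACHED list -/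

/-- **COROLLARY (c), REACHED list** (`m ≤ 200` squarefree): the smallest solutions of `x² − m·y² = 2` for the twenty-two reachable `m`
(every solution with `|x² − m y²| = 2 < √m` is a convergent of `√m`; the `y = 1` entries are the `m = b² − 2` fields). [kernel, `norm_num`] -/
theorem reached_list :
    (2 : ℤ) ^ 2 - 2 * 1 ^ 2 = 2 ∧ (3 : ℤ) ^ 2 - 7 * 1 ^ 2 = 2 ∧ (4 : ℤ) ^ 2 - 14 * 1 ^ 2 = 2 ∧ (5 : ℤ) ^ 2 - 23 * 1 ^ 2 = 2 ∧
    (39 : ℤ) ^ 2 - 31 * 7 ^ 2 = 2 ∧ (6 : ℤ) ^ 2 - 34 * 1 ^ 2 = 2 ∧ (156 : ℤ) ^ 2 - 46 * 23 ^ 2 = 2 ∧ (7 : ℤ) ^ 2 - 47 * 1 ^ 2 = 2 ∧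
    (8 : ℤ) ^ 2 - 62 * 1 ^ 2 = 2 ∧ (59 : ℤ) ^ 2 - 71 * 7 ^ 2 = 2 ∧ (9 : ℤ) ^ 2 - 79 * 1 ^ 2 = 2 ∧ (1464 : ℤ) ^ 2 - 94 * 151 ^ 2 = 2 ∧
    (477 : ℤ) ^ 2 - 103 * 47 ^ 2 = 2 ∧ (11 : ℤ) ^ 2 - 119 * 1 ^ 2 = 2 ∧ (2175 : ℤ) ^ 2 - 127 * 193 ^ 2 = 2 ∧
    (12 : ℤ) ^ 2 - 142 * 1 ^ 2 = 2 ∧ (41571 : ℤ) ^ 2 - 151 * 3383 ^ 2 = 2 ∧ (88 : ℤ) ^ 2 - 158 * 7 ^ 2 = 2 ∧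
    (13 : ℤ) ^ 2 - 167 * 1 ^ 2 = 2 ∧ (2999 : ℤ) ^ 2 - 191 * 217 ^ 2 = 2 ∧ (14 : ℤ) ^ 2 - 194 * 1 ^ 2 = 2 ∧
    (127539 : ℤ) ^ 2 - 199 * 9041 ^ 2 = 2 := by
  norm_num

/-- The **`y = 1` family**: `m = b² − 2` is always reached, by `(x, y) = (b, 1)`. [kernel, `ring`] -/
theorem family_y_one (b : ℤ) : b ^ 2 - (b ^ 2 - 2) * 1 ^ 2 = 2 := by
  ring

/-- Hence every reached `m` of the list is the value of a solution: `∃ x y, x² − m·y² = 2` for each of the twenty-two. [kernel] -/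
theorem reached_exists :
    ∀ m ∈ ([2, 7, 14, 23, 31, 34, 46, 47, 62, 71, 79, 94, 103, 119, 127, 142, 151, 158, 167, 191, 194, 199] : List ℤ),
      ∃ x y : ℤ, x ^ 2 - m * y ^ 2 = 2 := by
  intro m hm
  simp only [List.mem_cons, List.mem_nil_iff, or_false] at hm
  rcases hm with rfl | rfl | rfl | rfl | rfl | rfl | rfl | rfl | rfl | rfl | rfl | rfl | rfl | rfl | rfl | rfl | rfl | rfl |
    rfl | rfl | rfl | rfl
  · exact ⟨2, 1, by norm_num⟩
  · exact ⟨3, 1, by norm_num⟩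
  · exact ⟨4, 1, by norm_num⟩
  · exact ⟨5, 1, by norm_num⟩
  · exact ⟨39, 7, by norm_num⟩
  · exact ⟨6, 1, by norm_num⟩
  · exact ⟨156, 23, by norm_num⟩
  · exact ⟨7, 1, by norm_num⟩
  · exact ⟨8, 1, by norm_num⟩
  · exact ⟨59, 7, by norm_num⟩
  · exact ⟨9, 1, by norm_num⟩
  · exact ⟨1464, 151, by norm_num⟩
  · exact ⟨477, 47, by norm_num⟩
  · exact ⟨11, 1, by norm_num⟩
  · exact ⟨2175, 193, by norm_num⟩
  · exact ⟨12, 1, by norm_num⟩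
  · exact ⟨41571, 3383, by norm_num⟩
  · exact ⟨88, 7, by norm_num⟩
  · exact ⟨13, 1, by norm_num⟩
  · exact ⟨2999, 217, by norm_num⟩
  · exact ⟨14, 1, by norm_num⟩
  · exact ⟨127539, 9041, by norm_num⟩

/-! ## §5 Parities of a solution -/

/-- **`m ≡ 3 (mod 4)`**: a solution of `x² − m·y² = 2` has `x` and `y` odd (mod `4`: `x² + y² ≡ 2`). [kernel] -/
theorem parity_of_three_mod_four {m x y : ℤ} (hm : m % 4 = 3) (h : x ^ 2 - m * y ^ 2 = 2) : x % 2 = 1 ∧ y % 2 = 1 := by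
  have key : ∀ a b : ZMod 4, a ^ 2 - 3 * b ^ 2 = 2 → (a = 1 ∨ a = 3) ∧ (b = 1 ∨ b = 3) := by decide
  have hm4 : (m : ZMod 4) = 3 := by
    have e : m = 4 * (m / 4) + 3 := by omega
    have z4 : (4 : ZMod 4) = 0 := by decide
    rw [e]; push_cast; rw [z4, zero_mul, zero_add]
  have hc := congrArg (fun t : ℤ => (t : ZMod 4)) h
  push_cast at hc
  rw [hm4] at hc
  obtain ⟨ha, hb⟩ := key _ _ hc
  have vx : (((x : ZMod 4)).val : ℤ) = x % 4 := ZMod.val_intCast x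
  have vy : (((y : ZMod 4)).val : ℤ) = y % 4 := ZMod.val_intCast y
  have e1 : (1 : ZMod 4).val = 1 := rfl
  have e3 : (3 : ZMod 4).val = 3 := rfl
  constructor
  · rcases ha with ha | ha
    · rw [ha, e1] at vx; omega
    · rw [ha, e3] at vx; omega
  · rcases hb with hb | hb
    · rw [hb, e1] at vy; omega
    · rw [hb, e3] at vy; omega

/-- **`m ≡ 2 (mod 4)`**: a solution of `x² − m·y² = 2` has `x` even and `y` odd (mod `4`: `x² − 2y² ≡ 2`). [kernel] -/
theorem parity_of_two_mod_four {m x y : ℤ} (hm : m % 4 = 2) (h : x ^ 2 - m * y ^ 2 = 2) : x % 2 = 0 ∧ y % 2 = 1 := by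
  have key : ∀ a b : ZMod 4, a ^ 2 - 2 * b ^ 2 = 2 → (a = 0 ∨ a = 2) ∧ (b = 1 ∨ b = 3) := by decide
  have hm4 : (m : ZMod 4) = 2 := by
    have e : m = 4 * (m / 4) + 2 := by omega
    have z4 : (4 : ZMod 4) = 0 := by decide
    rw [e]; push_cast; rw [z4, zero_mul, zero_add]
  have hc := congrArg (fun t : ℤ => (t : ZMod 4)) h
  push_cast at hc
  rw [hm4] at hc
  obtain ⟨ha, hb⟩ := key _ _ hc
  have vx : (((x : ZMod 4)).val : ℤ) = x % 4 := ZMod.val_intCast x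
  have vy : (((y : ZMod 4)).val : ℤ) = y % 4 := ZMod.val_intCast y
  have e0 : (0 : ZMod 4).val = 0 := rfl
  have e1 : (1 : ZMod 4).val = 1 := rfl
  have e2 : (2 : ZMod 4).val = 2 := rfl
  have e3 : (3 : ZMod 4).val = 3 := rfl
  constructor
  · rcases ha with ha | ha
    · rw [ha, e0] at vx; omega
    · rw [ha, e2] at vx; omega
  · rcases hb with hb | hb
    · rw [hb, e1] at vy; omega
    · rw [hb, e3] at vy; omega

end Summit.Ventures.HSemireg.R1Diophantine
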